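import Summits.QuantumFields.QCD.Theorems.SpectralDefectExtinctionWindowExtinctionStubBoxBlockCut
import Summits.QuantumFields.QCD.Theorems.SpectralDefectExtinctionWindowExtinctionStubNegCountOpen
import Summits.QuantumFields.QCD.Theorems.SpectralDefectExtinctionWindowExtinctionStubFluxTemplateHalf
import Literature.MathematicalPhysics.QuantumFieldTheory.QCDPhaseQuenched
import Literature.MathematicalPhysics.QuantumFieldTheory.SpectralDefectDensity
import HarnessLib

/-!
# Assembly of the weak index-carrying template from the periodic carrier
# (stub `stub_indexTemplateWeak_of`, def-free twin `stub_indexTemplateWeak_of_inlined`)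

Stub `stub_indexTemplateWeak_of` (S12) of line `free-volume-heavy-witness` (reshape r4) of crux
`Summit.QuantumFields.QCD.Theses.SpectralDefectExtinction.WindowExtinction`
(item stmt-QuantumFields-8964).  The registered statement is
`BoxBlockReindex → NegCountOpen → BoxBlockCut → PeriodicIndexCarrier → IndexTemplateWeak` for the five
`def … : Prop` of the lead's skeleton (`Cruxes/WindowExtinction/Lines/free_volume_heavy_witness_c3.lean`,
§4b); here the bodies of these definitions are inlined verbatim (tree vocabulary only), so that in the
skeleton `theorem stub_indexTemplateWeak_of : … := fun h8 h9 h10 h11 =>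
stub_indexTemplateWeak_of_inlined h8 h9 h10 h11` (definitional unfolding).

The content of the proof (topology/measure plumbing):

* from the periodic carrier (S11) take the odd torus side `2R+1` and the field `U₀` whose Hermitian
  Wilson–Dirac operator `Γ₅ D_W(U₀, −δ, 1)` has `n₋ ≥ θ + 12((2R+1)⁴ − (2R−1)⁴)`,
  `θ = 6(2R+1)⁴ + 96(2R+1)³ + 1`, at every probe `δ ∈ [lo, hi]`; its link field read on the box
  `{−R, …, R}⁴` is the *content* `t₀(y, μ) = U₀(proj_{2R+1} y, μ)`;
* `weakOf_exists_refField` — on a reference torus of side `n₀ > 2R+1` with centre `c₀`, the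
  *reference field* `Φ t` of a content `t` (the links `t(y, μ)` on the image of the box, unit links
  elsewhere) depends continuously on `t` and has content `t`;
* by the cut (S10) the box block of `Γ₅ D_W(Φ t₀, −s, 1)` has `n₋ ≥ θ` for `s ∈ [lo, hi]`;
* `weakOf_continuous_family` — `(t, s) ↦` box block of `Γ₅ D_W(Φ t, −s, 1)` is jointly continuous
  (`continuous_wilsonDirac`, the bare mass enters additively `wilsonDirac_mass_eq_add_scalar`), and
  each value is Hermitian (γ₅-hermiticity, `isHermitian_hermitianWilsonDirac`); so lower
  semicontinuity with a uniform tube (S9) gives an OPEN set `V ∋ t₀` of contents with `n₋ ≥ θ` on the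
  whole window;
* `V` is measurable (open, and the finite product of copies of `SU(3)` is a Borel space) and
  Haar-positive (non-empty open; `haarProbability SU3` and its finite product charge open sets);
* reindexing (S8): the box block of ANY field on ANY torus `n > 2R+1` about ANY centre `c` whose content
  `t` lies in `V` is a re-indexing of the box block of `Γ₅ D_W(Φ t, −δ, 1)`, so it has the same `n₋`
  (`inertia_negRootCount_submatrix_equiv`).
-/

noncomputable section

namespace Summit.QuantumFields.QCD.Cruxes.WindowExtinction.FreeVolumeHeavyWitness

open scoped BigOperators Topology Classical ENNReal
open Filter MeasureTheory Matrix
open Literature.MathematicalPhysics.QuantumLattice Literature.MathematicalPhysics.QuantumFieldTheory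
  Literature.Probability.LatticeModels
open Summit.QuantumFields.QCD.Theorems.ExtinctionBuildsQCD.Negative

/-! ## The reference field of a content -/

/-- For `2R+1 ≤ n` a box point is recovered from its image on the torus: any chosen preimage in the
box of `proj n (c + y)` is `y` (`spread_proj_add_injective`). -/
theorem weakOf_choose_eq {R n : ℕ} (hn : 2 * R + 1 ≤ n) (c : Fin 4 → ℤ) (y : ↥(box 4 R))
    (h : ∃ y' : ↥(box 4 R), Torus.proj n (c + (y' : Fin 4 → ℤ)) = Torus.proj n (c + (y : Fin 4 → ℤ))) :
    h.choose = y :=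
  Subtype.ext (spread_proj_add_injective hn c h.choose.2 y.2 h.choose_spec)

/-- **The reference field of a content.**  On a torus of side `n ≥ 2R+1` with centre `c` there is a
map `Φ` from contents `t : box 4 R × Fin 4 → SU(3)` to gauge fields, continuous in `t` (product
topologies), such that the content of `Φ t` about `c` is `t`: `Φ t (proj n (c + y), μ) = t(y, μ)`.
(Take `t(y, μ)` on the links based in the image of the box — well defined as the box embeds — and the
unit elsewhere; each link of `Φ t` is either an evaluation of `t` or constant.) -/
theorem weakOf_exists_refField (R n : ℕ) (hn : 2 * R + 1 ≤ n) (c : Fin 4 → ℤ) :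
    ∃ Φ : (↥(box 4 R) × Fin 4 → SU3) → GaugeConfig 4 n SU3, Continuous Φ ∧
      ∀ (t : ↥(box 4 R) × Fin 4 → SU3) (y : ↥(box 4 R)) (μ : Fin 4),
        Φ t (Torus.proj n (c + (y : Fin 4 → ℤ)), μ) = t (y, μ) := by
  refine ⟨fun t e => if h : ∃ y : ↥(box 4 R), Torus.proj n (c + (y : Fin 4 → ℤ)) = e.1
      then t (h.choose, e.2) else 1, ?_, ?_⟩
  · refine continuous_pi fun e => ?_
    by_cases h : ∃ y : ↥(box 4 R), Torus.proj n (c + (y : Fin 4 → ℤ)) = e.1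
    · simp only [dif_pos h]
      exact continuous_apply _
    · simp only [dif_neg h]
      exact continuous_const
  · intro t y μ
    have h : ∃ y' : ↥(box 4 R), Torus.proj n (c + (y' : Fin 4 → ℤ)) = Torus.proj n (c + (y : Fin 4 → ℤ)) :=
      ⟨y, rfl⟩
    show (if h' : ∃ y' : ↥(box 4 R), Torus.proj n (c + (y' : Fin 4 → ℤ)) = Torus.proj n (c + (y : Fin 4 → ℤ))
      then t (h'.choose, μ) else 1) = t (y, μ)
    rw [dif_pos h, weakOf_choose_eq hn c y h]

/-! ## Joint continuity of the box block in (content, probe) -/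

/-- **Joint continuity of the box block.**  For a continuous family `Φ x` of gauge fields, the map
`(x, s) ↦` (any submatrix of) `Γ₅ D_W(Φ x, −s, 1)` is jointly continuous: `U ↦ D_W(U, 0, 1)` is
continuous (`continuous_wilsonDirac`, the fundamental representation being continuous), the bare mass
enters additively (`D_W(U, −s, 1) = D_W(U, 0, 1) + (−s)·1`, `wilsonDirac_mass_eq_add_scalar`), and left
multiplication by the constant `Γ₅` and re-indexing are continuous. -/
theorem weakOf_continuous_family {X : Type*} [TopologicalSpace X] {n : ℕ} [NeZero n] {ι : Type*}
    {Φ : X → GaugeConfig 4 n SU3} (hΦ : Continuous Φ) (f : ι → TorusSite 4 n × Fin 3 × Fin 4) :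
    Continuous fun p : X × ℝ =>
      (spinorLift gammaFive * wilsonDirac (fundamentalRep (Fin 3)) (Φ p.1) (-p.2) 1).submatrix f f := by
  have h1 : Continuous fun p : X × ℝ => wilsonDirac (fundamentalRep (Fin 3)) (Φ p.1) (-p.2) 1 := by
    have e : (fun p : X × ℝ => wilsonDirac (fundamentalRep (Fin 3)) (Φ p.1) (-p.2) 1) = fun p =>
        wilsonDirac (fundamentalRep (Fin 3)) (Φ p.1) 0 1 +
          Matrix.diagonal (fun _ : TorusSite 4 n × Fin 3 × Fin 4 => (((-p.2 : ℝ)) : ℂ)) := by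
      funext p
      rw [wilsonDirac_mass_eq_add_scalar (fundamentalRep (Fin 3)) (Φ p.1) (-p.2) 1, Matrix.scalar_apply]
    rw [e]
    exact ((continuous_wilsonDirac _ (continuous_fundamentalRep (Fin 3)) 0 1).comp
      (hΦ.comp continuous_fst)).add
      (continuous_pi fun _ => Complex.continuous_ofReal.comp continuous_snd.neg).matrix_diagonal
  exact (continuous_const.matrix_mul h1).matrix_submatrix f f

/-! ## The stub (def-free twin) -/

/-- **STUB S12 `stub_indexTemplateWeak_of`, inlined form** (see the module docstring): reindexing
(S8), lower semicontinuity of the negative count with a uniform tube (S9), the cut to the periodic torus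
(S10) and the periodic index carrier (S11) give the weak index-carrying template (S5b-p′): for every
window a radius `R` and an open (hence measurable), Haar-positive template class `Tp` of box contents
such that every field whose box content lies in `Tp` has box block of `Γ₅ D_W(·, −δ, 1)` with at least
`6(2R+1)⁴ + 96(2R+1)³ + 1` negative eigenvalues at every probe `δ` of the window. -/
theorem stub_indexTemplateWeak_of_inlined :
    (∀ (R n : ℕ) [NeZero n] (n' : ℕ) [NeZero n'], 2 * R + 1 < n → 2 * R + 1 < n' →
      ∀ (c c' : Fin 4 → ℤ) (U : GaugeConfig 4 n SU3) (U' : GaugeConfig 4 n' SU3),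
        (∀ (y : ↥(box 4 R)) (μ : Fin 4),
          U' (Torus.proj n' (c' + (y : Fin 4 → ℤ)), μ) = U (Torus.proj n (c + (y : Fin 4 → ℤ)), μ)) →
        ∃ e : {p : TorusSite 4 n × Fin 3 × Fin 4 // ∃ y : ↥(box 4 R), Torus.proj n (c + (y : Fin 4 → ℤ)) = p.1} ≃
            {p : TorusSite 4 n' × Fin 3 × Fin 4 // ∃ y : ↥(box 4 R), Torus.proj n' (c' + (y : Fin 4 → ℤ)) = p.1},
          ∀ δ : ℝ,
            (spinorLift gammaFive * wilsonDirac (fundamentalRep (Fin 3)) U' (-δ) 1).submatrix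
                (Subtype.val : {p : TorusSite 4 n' × Fin 3 × Fin 4 //
                  ∃ y : ↥(box 4 R), Torus.proj n' (c' + (y : Fin 4 → ℤ)) = p.1} → _) Subtype.val =
              ((spinorLift gammaFive * wilsonDirac (fundamentalRep (Fin 3)) U (-δ) 1).submatrix
                (Subtype.val : {p : TorusSite 4 n × Fin 3 × Fin 4 //
                  ∃ y : ↥(box 4 R), Torus.proj n (c + (y : Fin 4 → ℤ)) = p.1} → _) Subtype.val).submatrix
                e.symm e.symm) →
    (∀ {X : Type} [TopologicalSpace X] {ι : Type} [Fintype ι] [DecidableEq ι] (F : X → ℝ → Matrix ι ι ℂ),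
      Continuous (fun p : X × ℝ => F p.1 p.2) → (∀ x s, (F x s).IsHermitian) →
      ∀ (θ : ℕ) (x₀ : X) (lo hi : ℝ), (∀ s : ℝ, lo ≤ s → s ≤ hi → θ ≤ negRootCount (F x₀ s)) →
        ∃ V : Set X, IsOpen V ∧ x₀ ∈ V ∧ ∀ x ∈ V, ∀ s : ℝ, lo ≤ s → s ≤ hi → θ ≤ negRootCount (F x s)) →
    (∀ (R : ℕ) (U₀ : GaugeConfig 4 (2 * R + 1) SU3) (δ : ℝ) (n : ℕ) [NeZero n], 2 * R + 1 < n →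
      ∀ (c : Fin 4 → ℤ) (U : GaugeConfig 4 n SU3),
        (∀ (y : ↥(box 4 R)) (μ : Fin 4),
          U (Torus.proj n (c + (y : Fin 4 → ℤ)), μ) = U₀ (Torus.proj (2 * R + 1) (y : Fin 4 → ℤ), μ)) →
        negRootCount (spinorLift gammaFive * wilsonDirac (fundamentalRep (Fin 3)) U₀ (-δ) 1) ≤
          negRootCount ((spinorLift gammaFive * wilsonDirac (fundamentalRep (Fin 3)) U (-δ) 1).submatrix
              (Subtype.val : {p : TorusSite 4 n × Fin 3 × Fin 4 //
                ∃ y : ↥(box 4 R), Torus.proj n (c + (y : Fin 4 → ℤ)) = p.1} → _) Subtype.val) +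
            12 * ((2 * R + 1) ^ 4 - (2 * R - 1) ^ 4)) →
    (∀ (Q : ℕ) (lo hi : ℝ), 0 < lo → lo ≤ hi → hi ≤ Q * lo → hi ≤ 1 / 4 →
      ∃ (R : ℕ) (U₀ : GaugeConfig 4 (2 * R + 1) SU3), ∀ δ : ℝ, lo ≤ δ → δ ≤ hi →
        6 * (2 * R + 1) ^ 4 + 96 * (2 * R + 1) ^ 3 + 1 + 12 * ((2 * R + 1) ^ 4 - (2 * R - 1) ^ 4) ≤
          negRootCount (spinorLift gammaFive * wilsonDirac (fundamentalRep (Fin 3)) U₀ (-δ) 1)) →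
    (∀ (Q : ℕ) (lo hi : ℝ), 0 < lo → lo ≤ hi → hi ≤ Q * lo → hi ≤ 1 / 4 →
      ∃ (R : ℕ) (Tp : Set ((↥(box 4 R) × Fin 4) → SU3)), MeasurableSet Tp ∧
        (Measure.pi fun _ : ↥(box 4 R) × Fin 4 => haarProbability SU3) Tp ≠ 0 ∧
        ∀ δ : ℝ, lo ≤ δ → δ ≤ hi → ∀ (n : ℕ) [NeZero n], 2 * R + 1 < n →
          ∀ (c : Fin 4 → ℤ) (U : GaugeConfig 4 n SU3),
            (fun yi : ↥(box 4 R) × Fin 4 => U (Torus.proj n (c + (yi.1 : Fin 4 → ℤ)), yi.2)) ∈ Tp →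
            6 * (2 * R + 1) ^ 4 + 96 * (2 * R + 1) ^ 3 + 1 ≤
              negRootCount ((spinorLift gammaFive * wilsonDirac (fundamentalRep (Fin 3)) U (-δ) 1).submatrix
                (Subtype.val : {p : TorusSite 4 n × Fin 3 × Fin 4 //
                  ∃ y : ↥(box 4 R), Torus.proj n (c + (y : Fin 4 → ℤ)) = p.1} → _) Subtype.val)) := by
  intro h8 h9 h10 h11 Q lo hi hlo hlohi hQ hhi
  -- S11: the periodic carrier `U₀` on the odd torus of side `2R+1`
  obtain ⟨R, U₀, hcar⟩ := h11 Q lo hi hlo hlohi hQ hhi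
  -- a reference torus of side `n₀ > 2R+1` and a reference centre `c₀`
  obtain ⟨n₀, hn₀⟩ : ∃ n₀ : ℕ, 2 * R + 1 < n₀ := ⟨2 * R + 2, by omega⟩
  haveI : NeZero n₀ := ⟨by omega⟩
  obtain ⟨c₀, -⟩ : ∃ c₀ : Fin 4 → ℤ, True := ⟨0, trivial⟩
  -- the reference field of a content
  obtain ⟨Φ, hΦc, hΦ⟩ := weakOf_exists_refField R n₀ hn₀.le c₀
  -- the family of box blocks of the reference fields
  obtain ⟨F, hF⟩ : ∃ F : (↥(box 4 R) × Fin 4 → SU3) → ℝ →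
      Matrix {p : TorusSite 4 n₀ × Fin 3 × Fin 4 // ∃ y : ↥(box 4 R), Torus.proj n₀ (c₀ + (y : Fin 4 → ℤ)) = p.1}
        {p : TorusSite 4 n₀ × Fin 3 × Fin 4 // ∃ y : ↥(box 4 R), Torus.proj n₀ (c₀ + (y : Fin 4 → ℤ)) = p.1} ℂ,
      ∀ t s, F t s = (spinorLift gammaFive * wilsonDirac (fundamentalRep (Fin 3)) (Φ t) (-s) 1).submatrix
        (Subtype.val : {p : TorusSite 4 n₀ × Fin 3 × Fin 4 //
          ∃ y : ↥(box 4 R), Torus.proj n₀ (c₀ + (y : Fin 4 → ℤ)) = p.1} → _) Subtype.val :=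
    ⟨_, fun _ _ => rfl⟩
  have hFc : Continuous fun p : (↥(box 4 R) × Fin 4 → SU3) × ℝ => F p.1 p.2 := by
    simp only [hF]
    exact weakOf_continuous_family hΦc _
  have hFh : ∀ t s, (F t s).IsHermitian := fun t s => by
    rw [hF]
    exact (Literature.Barriers.QuantumFields.WilsonDeterminant.isHermitian_hermitianWilsonDirac _
      fundamentalRep_mem_unitaryGroup (Φ t) (-s) 1).submatrix _
  -- the content of the carrier
  obtain ⟨t₀, ht₀⟩ : ∃ t₀ : ↥(box 4 R) × Fin 4 → SU3,
      ∀ (y : ↥(box 4 R)) (μ : Fin 4), t₀ (y, μ) = U₀ (Torus.proj (2 * R + 1) (y : Fin 4 → ℤ), μ) :=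
    ⟨fun yi => U₀ (Torus.proj (2 * R + 1) (yi.1 : Fin 4 → ℤ), yi.2), fun _ _ => rfl⟩
  -- S10 + S11: the box block of the reference field of `t₀` has `n₋ ≥ θ` on the window
  have hθ : ∀ s : ℝ, lo ≤ s → s ≤ hi →
      6 * (2 * R + 1) ^ 4 + 96 * (2 * R + 1) ^ 3 + 1 ≤ negRootCount (F t₀ s) := by
    intro s hs1 hs2
    have h2 := h10 R U₀ s n₀ hn₀ c₀ (Φ t₀) (fun y μ => by rw [hΦ, ht₀])
    rw [hF]
    exact Nat.le_of_add_le_add_right ((hcar s hs1 hs2).trans h2)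
  -- S9: an open set of contents with the same bound
  obtain ⟨V, hVo, hV₀, hV⟩ := h9 F hFc hFh _ t₀ lo hi hθ
  haveI : (haarProbability SU3).IsOpenPosMeasure := by
    unfold haarProbability; infer_instance
  refine ⟨R, V, hVo.measurableSet, (hVo.measure_pos _ ⟨t₀, hV₀⟩).ne', ?_⟩
  -- S8: transport to every torus, centre and field with content in `V`
  intro δ hδ1 hδ2 n _ hn c U hU
  have hθ' := hV _ hU δ hδ1 hδ2
  rw [hF] at hθ'
  obtain ⟨e, he⟩ := h8 R n n₀ hn hn₀ c c₀ U
    (Φ fun yi : ↥(box 4 R) × Fin 4 => U (Torus.proj n (c + (yi.1 : Fin 4 → ℤ)), yi.2)) (fun y μ => hΦ _ y μ)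
  have h4 := congrArg negRootCount (he δ)
  rw [inertia_negRootCount_submatrix_equiv] at h4
  exact hθ'.trans_eq h4

end Summit.QuantumFields.QCD.Cruxes.WindowExtinction.FreeVolumeHeavyWitness

end
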